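import Summits.HodgeConjecture.HodgeConjecture.Theorems.K2E1ChiLocalWeightShellU2                    -- ★ p862239 (this seat) FILE 2: `chiLocalMean_weight_eq_chiLocalScalar` ((T) with `e = ∏_{w∣v} χ_w(π_w)`)
import Summits.HodgeConjecture.HodgeConjecture.Theorems.K2E1ChiIntertwiningLocalScalarFromK2LiuU2    -- ★ p861884 J1a: `unramValue_chiF_localComponent_eq_valueAtUniformizer`; brings ★ `unramValue_chiF_eq_prod`, `unifAt`, `valued_unifAt`, `toPlace`
import HarnessLib

/-!
# K2·E1 ∕ R90·S8 — `K2E1ChiLocalWeightTokenU2` (J2′-2-NONSPLIT, FILE 3): the shell parameter IS `ε(ϖ_v)` — `∏_{w∣v} χ_w(ι_w ϖ_v) = ε.valueAtUniformizer v` for `ε = χ|_{𝕀_{L⁺}}` —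
# and letter (T) of J2′-1 in its EXACT token `(1 − ε.valueAtUniformizer v · q_v^{−2z})(1 − ε.valueAtUniformizer v · q_v^{−(2z−1)})⁻¹` for the Iwasawa weight

Cell `pub/hodgecm-mathlib`, crux h413 = `stmt-HodgeConjecture-24833`, route of record `HCCMUnconditional`; R90-TF section S8 «ContSpec-n½», deal S8-R19 ∕ S8-R22 (R90-CS-plan (g2))
«J2′-2-NONSPLIT» to R90-C10-p07 (g0), FILE 3 (FILE 1 ★ p862220, FILE 2 ★ p862239).  THEOREMS ONLY (no `def`, no `instance`, no notation, no named-fact hypothesis, no `sorry`; default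
heartbeats); lane `--supports stmt-HodgeConjecture-24833 --as helper` (count-neutral; closes no socket).

THE SEAM CLOSED HERE.  FILE 2 reads (T) with the explicit parameter `e = ∏_{w∣v} χ_w(π_w)`, `π_w = ι_w ϖ_v` along E1's `ι_w = Extension.adicCompletionSemialgHom L⁺ L w`; ★ J1a-dict
(`K2E1ChiIntertwiningLocalScalarFromK2LiuU2.unramValue_chiF_localComponent_eq_valueAtUniformizer` + ★ `K2LiuGKRankOneIdentityLFactor.unramValue_chiF_eq_prod`) reads
`∏_{w∣v} χ_w(toPlace v w ϖ_v) = ε.valueAtUniformizer v` along K2Liu's `toPlace`.  The two canonical maps `L⁺_v → L_w` AGREE DEFINITIONALLY (★ `AdelicBaseChange.AutomorphicCompat.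
adicCompletionSemialgHom_apply_eq_adicCompletionOfLiesOver` is `rfl`; `toPlace v w = adicCompletionOfLiesOver … w.1`), and the index types `v.Extension (𝓞 L)` ∕ `UnitaryGroup.PlacesOver L v` are the same
subtype, so:
* §1 **`prod_localComponent_unif_eq_valueAtUniformizer`** — for a Hecke character `χ` of `L` with `χ ∘ (base change) = ε` and `χ_w` unramified at every `w ∣ v`:
  `∏_{w∣v} χ_w(π_w) = ε.valueAtUniformizer v` for units `π_w` representing `ι_w(unifAt L⁺ v)`.
* §2 **`chiLocalMean_weight_eq_valueAtUniformizer_token`** — letter (T) of K2E1-p13's `K2E1ChiIntertwiningScalarEulerProductU2` `htok` for the Iwasawa weight of a UNITARY `χ` unramified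
  above `v` (off `S_δ`): `ν_v(𝒪_v)⁻¹ ∫ ω_v·P_v^{−z} dν_v = (1 − ε.valueAtUniformizer v · q_v^{−2z})·(1 − ε.valueAtUniformizer v · q_v^{−(2z−1)})⁻¹`, `½ < Re z`, in ★ p861744's integrand
  bytes and ★ p861632's token bytes (FILE 2 §4 + §1).
HONEST LABEL: HC_CM is proved only modulo the 7 printed citations (2 remaining named inputs: hLiu418 = `stmt-HodgeConjecture-24832`, h413 = `stmt-HodgeConjecture-24833`) until rung 0
closes; REL ≠ ★ ≠ BUILT; this file asserts no named fact and closes no socket; count-neutral.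

## References
* [TateThesis1967] J. Tate, *Fourier analysis in number fields and Hecke's zeta-functions*, in Cassels–Fröhlich (1967), §4.3 (local components, `χ(ϖ_v)`).
* [Casselman1980] W. Casselman, *The unramified principal series of p-adic groups I*, Compositio Math. 40 (1980), §3 Thm. 3.1.
* [CasselsFrohlichANT1967] J. W. S. Cassels, A. Fröhlich (eds.), *Algebraic Number Theory* (1967), Ch. II §10 (the canonical `k_v → K_w`).
-/

set_option autoImplicit false
set_option linter.dupNamespace false

noncomputable section

open MeasureTheory Measure NumberField IsDedekindDomain IsDedekindDomain.HeightOneSpectrum Set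
open scoped NNReal ENNReal
open Literature.NumberTheory.GaloisRepresentations Literature.NumberTheory.GaloisRepresentations.IsNonarchimedeanLocalField
open Literature.NumberTheory.Automorphic Literature.NumberTheory.Automorphic.UnitaryGroup Literature.NumberTheory.Automorphic.LocalFieldHaar
open Summit.HodgeConjecture.HodgeConjecture.Cruxes.HLiu418.K2LiuLocalLFactorDefs
open Summit.HodgeConjecture.HodgeConjecture.Cruxes.HLiu418.K2LiuGKRankOneIdentityLFactor (unramValue_chiF_eq_prod)
open Summit.HodgeConjecture.HodgeConjecture.Cruxes.H413.K2E1ChiIntertwiningLocalScalarFromK2LiuU2 (unramValue_chiF_localComponent_eq_valueAtUniformizer)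

namespace Summit.HodgeConjecture.HodgeConjecture.Cruxes.H413.K2E1ChiLocalWeightTokenU2

variable (L : Type) [Field L] [NumberField L] [IsCMField L] (v : HeightOneSpectrum (𝓞 ↥(maximalRealSubfield L)))

/-! ## §1 `∏_{w∣v} χ_w(ι_w ϖ_v) = ε.valueAtUniformizer v` along E1's `ι_w` -/

omit [IsCMField L] in
/-- **THE SHELL PARAMETER IS `ε(ϖ_v)`.**  For a Hecke character `χ` of `L` and `ε` of `L⁺` with `χ ∘ (base change) = ε` (hypothesis-first), `χ_w = χ.localComponent w` unramified at every `w ∣ v`,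
and units `π_w` of `L_w` with `π_w = ι_w(unifAt L⁺ v)` (`ι_w = Extension.adicCompletionSemialgHom L⁺ L w`): `∏_{w∣v} χ_w(π_w) = ε.valueAtUniformizer v`.  ★ J1a-dict + ★ `unramValue_chiF_eq_prod`,
transported along `toPlace v w = Extension.adicCompletionSemialgHom L⁺ L w` (`rfl`, ★ `adicCompletionSemialgHom_apply_eq_adicCompletionOfLiesOver`). [cite: TateThesis1967, §4.3] [cite: Casselman1980, §3] -/
theorem prod_localComponent_unif_eq_valueAtUniformizer (χ : HeckeCharacter L) (ε : HeckeCharacter ↥(maximalRealSubfield L))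
    (hε : ∀ a : ideleGroup ↥(maximalRealSubfield L), χ (AdeleRing.ideleBaseChange ↥(maximalRealSubfield L) L a) = ε a)
    (hχ : ∀ (w : v.Extension (𝓞 L)) (u : (w.1.adicCompletion L)ˣ), Valued.v (u : w.1.adicCompletion L) = 1 → χ.localComponent w.1 u = 1)
    (π : ∀ w : v.Extension (𝓞 L), (w.1.adicCompletion L)ˣ)
    (hπ : ∀ w : v.Extension (𝓞 L), ((π w : (w.1.adicCompletion L)ˣ) : w.1.adicCompletion L) =
      Extension.adicCompletionSemialgHom ↥(maximalRealSubfield L) L w (unifAt ↥(maximalRealSubfield L) v)) :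
    (letI := Extension.fintype (𝓞 ↥(maximalRealSubfield L)) ↥(maximalRealSubfield L) L (𝓞 L) v; ∏ w : v.Extension (𝓞 L), ((χ.localComponent w.1 (π w) : ℂˣ) : ℂ)) =
      ε.valueAtUniformizer v := by
  letI := Extension.fintype (𝓞 ↥(maximalRealSubfield L)) ↥(maximalRealSubfield L) L (𝓞 L) v
  have hϖ0 : ∀ w : PlacesOver L v, toPlace v w (unifAt ↥(maximalRealSubfield L) v) ≠ 0 :=
    fun w => (map_ne_zero (toPlace v w)).2 (unifAt_ne_zero ↥(maximalRealSubfield L) v)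
  have hχ' : ∀ (w : PlacesOver L v) (u : (w.1.adicCompletion L)ˣ), Valued.v (u : w.1.adicCompletion L) = 1 → χ.localComponent w.1 u = 1 :=
    fun w u hu => hχ w u hu
  rw [← unramValue_chiF_localComponent_eq_valueAtUniformizer v χ ε hε hχ',
    unramValue_chiF_eq_prod ↥(maximalRealSubfield L) L v (fun w => χ.localComponent w.1) hχ' (valued_unifAt ↥(maximalRealSubfield L) v) hϖ0, Units.coe_prod]
  refine Fintype.prod_equiv (Equiv.refl _) _ _ fun w => ?_
  rw [Equiv.refl_apply]
  congr 2
  exact Units.ext (hπ w)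

/-! ## §2 Letter (T) in its exact token for the Iwasawa weight of a unitary unramified `χ` -/

/-- **LETTER (T) OF J2′-1, EXACT TOKEN.**  At a finite place `v` of `L⁺` with `‖δ‖_w = 1` for all `w ∣ v`, for a UNITARY Hecke character `χ` of `L` unramified above `v` with `χ ∘ (base change) = ε`,
`½ < Re z`, and the Iwasawa weight `ω_v` (`= 1` on `𝒪_v`, `= ∏_{w∣v} χ_w(a_w(t))` off `𝒪_v`, units `a_w(t) = −(ι_w t·δ_w)⁻¹`, `π_w = ι_w(unifAt L⁺ v)`):
`t ↦ ω_v(t)·P_v(t)^{−z}` is integrable and `ν_v(𝒪_v)⁻¹ ∫ ω_v·P_v^{−z} dν_v = (1 − ε.valueAtUniformizer v · q_v^{−2z})·(1 − ε.valueAtUniformizer v · q_v^{−(2z−1)})⁻¹` — the `htok` binder of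
`K2E1ChiIntertwiningScalarEulerProductU2` (K2E1-p13 (g4)) at this `v`, in ★ p861744's integrand bytes and ★ p861632's token bytes (★ FILE 2 §4 + §1; `‖χ_w‖ = 1` from unitarity).
[cite: Casselman1980, §3 Thm. 3.1] [cite: Langlands1976, Appendix] [cite: Rogawski1990, §13.9 p. 229] [cite: TateThesis1967, §4.3] -/
theorem chiLocalMean_weight_eq_valueAtUniformizer_token {δ : L}
    [MeasurableSpace (v.adicCompletion ↥(maximalRealSubfield L))] [BorelSpace (v.adicCompletion ↥(maximalRealSubfield L))]
    (μ : Measure (v.adicCompletion ↥(maximalRealSubfield L))) [μ.IsAddHaarMeasure]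
    (hv : ∀ w : v.Extension (𝓞 L), normAbs (w.1.adicCompletion L) ((algebraMap L (FiniteAdeleRing (𝓞 L) L) δ) w.1) = 1)
    (χ : HeckeCharacter L) (hχu : χ.IsUnitary) (ε : HeckeCharacter ↥(maximalRealSubfield L))
    (hε : ∀ a : ideleGroup ↥(maximalRealSubfield L), χ (AdeleRing.ideleBaseChange ↥(maximalRealSubfield L) L a) = ε a)
    (hχ : ∀ (w : v.Extension (𝓞 L)) (u : (w.1.adicCompletion L)ˣ), Valued.v (u : w.1.adicCompletion L) = 1 → χ.localComponent w.1 u = 1)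
    (a : ∀ w : v.Extension (𝓞 L), v.adicCompletion ↥(maximalRealSubfield L) → (w.1.adicCompletion L)ˣ)
    (ha : ∀ (w : v.Extension (𝓞 L)) (t : v.adicCompletion ↥(maximalRealSubfield L)), t ∉ v.adicCompletionIntegers ↥(maximalRealSubfield L) →
      ((a w t : (w.1.adicCompletion L)ˣ) : w.1.adicCompletion L) =
        -(Extension.adicCompletionSemialgHom ↥(maximalRealSubfield L) L w t * (algebraMap L (FiniteAdeleRing (𝓞 L) L) δ) w.1)⁻¹)
    (π : ∀ w : v.Extension (𝓞 L), (w.1.adicCompletion L)ˣ)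
    (hπ : ∀ w : v.Extension (𝓞 L), ((π w : (w.1.adicCompletion L)ˣ) : w.1.adicCompletion L) =
      Extension.adicCompletionSemialgHom ↥(maximalRealSubfield L) L w (unifAt ↥(maximalRealSubfield L) v))
    {z : ℂ} (hz : 1 / 2 < z.re)
    (ω : v.adicCompletion ↥(maximalRealSubfield L) → ℂ)
    (hω0 : ∀ t ∈ v.adicCompletionIntegers ↥(maximalRealSubfield L), ω t = 1)
    (hωout : ∀ t : v.adicCompletion ↥(maximalRealSubfield L), t ∉ v.adicCompletionIntegers ↥(maximalRealSubfield L) →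
      ω t = (letI := Extension.fintype (𝓞 ↥(maximalRealSubfield L)) ↥(maximalRealSubfield L) L (𝓞 L) v; ∏ w : v.Extension (𝓞 L), ((χ.localComponent w.1 (a w t) : ℂˣ) : ℂ))) :
    Integrable (fun t : v.adicCompletion ↥(maximalRealSubfield L) => ω t * ((((letI := Extension.fintype (𝓞 ↥(maximalRealSubfield L)) ↥(maximalRealSubfield L) L (𝓞 L) v; ∏ w : v.Extension (𝓞 L), max 1 (normAbs (w.1.adicCompletion L) (Extension.adicCompletionSemialgHom ↥(maximalRealSubfield L) L w t) * normAbs (w.1.adicCompletion L) ((algebraMap L (FiniteAdeleRing (𝓞 L) L) δ) w.1))) : ℝ≥0) : ℝ) : ℂ) ^ (-z)) μ ∧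
    ((((μ (v.adicCompletionIntegers ↥(maximalRealSubfield L))).toReal⁻¹ : ℝ)) : ℂ) *
      ∫ t : v.adicCompletion ↥(maximalRealSubfield L), ω t * ((((letI := Extension.fintype (𝓞 ↥(maximalRealSubfield L)) ↥(maximalRealSubfield L) L (𝓞 L) v; ∏ w : v.Extension (𝓞 L), max 1 (normAbs (w.1.adicCompletion L) (Extension.adicCompletionSemialgHom ↥(maximalRealSubfield L) L w t) * normAbs (w.1.adicCompletion L) ((algebraMap L (FiniteAdeleRing (𝓞 L) L) δ) w.1))) : ℝ≥0) : ℝ) : ℂ) ^ (-z) ∂μ =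
    (1 - ε.valueAtUniformizer v * (v.residueCard : ℂ) ^ (-(2 * z))) * (1 - ε.valueAtUniformizer v * (v.residueCard : ℂ) ^ (-(2 * z - 1)))⁻¹ := by
  have hχb : ∀ (w : v.Extension (𝓞 L)) (u : (w.1.adicCompletion L)ˣ), ‖((χ.localComponent w.1 u : ℂˣ) : ℂ)‖ ≤ 1 := fun w u => by
    rw [HeckeCharacter.localComponent_apply]
    exact (hχu _).le
  rw [← prod_localComponent_unif_eq_valueAtUniformizer L v χ ε hε hχ π hπ]
  exact K2E1ChiLocalWeightShellU2.chiLocalMean_weight_eq_chiLocalScalar L v μ hv (fun w => χ.localComponent w.1) hχ hχb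
    (valued_unifAt ↥(maximalRealSubfield L) v) a ha π hπ hz ω hω0 hωout

end Summit.HodgeConjecture.HodgeConjecture.Cruxes.H413.K2E1ChiLocalWeightTokenU2

end
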